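/-
Origin: expansion seat `literature-prover-pub-hodgecm-cf-rogawski-0`, handover v4 2026-08-18 (`HOME/pub-hodgecm-cf-rogawski/RogawskiConsequences.lean`, md5 f6c365d9, 368 lines);
landed by the gen-6 packager in gate run 22 REPLACES the earlier landed copy of `HodgeCM/Literature/RogawskiConsequences.lean` (verbatim).
-/
/-
Copyright: pub-hodgecm formalisation cell (harness21, 2026). New file (not vendored).
Origin: HOME/pub-hodgecm-cf-rogawski/RogawskiConsequences.lean — CITED-FACT seat (4), session
literature-prover-pub-hodgecm-cf-rogawski-0, 2026-08-18. Suggested target: `HodgeCM/Literature/RogawskiConsequences.lean`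
(or `HodgeCM/Proofs/…`, packager's call: this file contains DERIVED statements, no citation).
-/
import Summits.HodgeConjecture.HodgeCM.Literature.Rogawski_2

/-!
# What input (R) delivers by itself: the (R)-skeleton of [Y1neg] Lemma 4.1 and Proposition 5.3, kernel-checked

`HodgeCM.Literature.Rogawski` types input (R) (= [DR15] Def 3.1 / Thm 3.2, after [Rog90]) as named hypotheses over
the posited carrier `U3Spectrum`.  This file records, with proofs, the two purely formal consequences of (R) that
[Y1neg] v2 (`inputs/2001/…neg-y1__paper-v2-977557c2.tex`) draws in its Lemma 4.1 (l. 136–140: "`μ(π)` … depends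
only on the eigensystem `a_π` (indeed on its restriction to any cofinite set of places)") and in the mechanism of
its Proposition 5.3 (ll. 179–184: "all `π'` in the eigenspace are of the same kind"), first for `τ = 1` and
then for general `τ ∈ Aut(ℂ)` (the `Aut(ℂ)`-action on eigensystems, [Y1neg] (eq:satconj), enters as a hypothesis):

* `U3Spectrum.lval_eq_ae` — two automorphic members of packets `Π(λ,ν)`, `Π(λ',ν')` (pairs in `Ξ`) with the same
  Satake parameters at almost all places have `λ_w(ϖ_w) = λ'_w(ϖ_w)` at almost all places;
* `U3Spectrum.holomorphy_determined_by_satake` — hence (given strong multiplicity one for Hecke characters) they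
  have the same holomorphy type at `ι`: if one is `π⁺`, the other is not `π⁻`;
* `U3Spectrum.cmType_twist_of_satake_twist` / `holomorphic_iff_of_satake_twist` — the Galois-twisted forms
  ([Y1neg] Lemma 5.2 "`Φ'(π') = τΦ'(π)`" and Proposition 5.3 "the `a^τ`-eigenspace is of type `(1,0)` iff
  `φ₁^h ∈ τΦ'(π)`", ll. 166–179) for `τ ∈ Aut(ℂ)` (`τ : ℂ ≃+* ℂ`), with [Y1neg]'s (eq:satconj) entering as the
  HYPOTHESIS "the Satake parameters of `π'` are the `τ`-images of those of `π` at almost all places" and one more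
  standard input `StandardInputs.Std_autTwist` (algebraic Hecke characters under `Aut(ℂ)`; GAPS pv01-G1 (E3); declared in the
  NON-CITABLE `HodgeCM/Automorphic/StandardInputs.lean`, referee 3 R3-6 V6).
  These kernel-check the links (E3) and (E4) of GAPS.md pv01-G1's chain behind (eq:Na), over the cited (R).

INPUTS, all displayed as hypotheses: the derived `holomorphyDichotomy` (proved in `HodgeCM.Literature.Rogawski`
from [DR15] Thm 3.2 (i)/(ii)/§3.1 verbatim + the reading `reading_fixedRule` + the standard input
`StandardInputs.Std_sqInt_tempered`) and `thm32_satake_Y1negReading` ([DR15] (12)+(i), [Y1neg]'s reading); two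
DEFINITIONAL carrier constraints named below (`UnitaryValues`, `OneLtQCard` — unitary characters have unit values on
uniformisers; residue fields have ≥ 2 elements); and two STANDARD INPUTS that are NOT declared in this citable file
but in the NON-CITABLE `HodgeCM/Automorphic/StandardInputs.lean` (referee 3 R3-6 V6) and are instantiated here at the
carrier's fields: `StandardInputs.Std_heckeCharRigid S.lval` (rigidity of Hecke characters — "strong multiplicity
one for `GL(1)`"; proof sketch: a continuous character of `𝔸_M^×/M^×` trivial on `M_w^×` for all `w` outside a
finite set is trivial, by weak approximation) and `StandardInputs.Std_autTwist S.InXi S.lval S.qCard S.expo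
autTwistAct` (`Aut(ℂ)`-twists of algebraic Hecke characters).  Nothing here is a citation; nothing is PerL's.
-/

noncomputable section

open NumberField NumberField.ComplexEmbedding

namespace HodgeCM

open Literature.AlgebraicGeometry.Motives (CMType)
open CMTypeOps

namespace Literature.Rogawski.U3Spectrum

variable {M : CMField} {ι : M →+* ℂ} {V : HermSpace3 M ι} (S : U3Spectrum M ι V)

/-- The Satake multiset of [Y1neg] display (4) = (eq:sat) (the literal inlined in `thm32_satake_Y1negReading`):
`{ν_M,w(ϖ_w), λ_w(ϖ_w) q_w^{1/2}, λ_w(ϖ_w) q_w^{−1/2}}`. -/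
def satMultiset (lam : S.HChar) (nu : S.AChar) (w : S.FinPlace) : Multiset ℂ :=
  {S.nval nu w, S.lval lam w * (Real.sqrt (S.qCard w) : ℂ), S.lval lam w * ((Real.sqrt (S.qCard w) : ℂ)⁻¹)}

/-- (Ported verbatim from the HodgeCMPerL package; no docstring in the source.) -/
theorem thm32_satake_Y1negReading_iff :
    S.thm32_satake_Y1negReading ↔
      ∀ (lam : S.HChar) (nu : S.AChar), S.InXi lam nu → ∀ π ∈ S.packet lam nu, S.m π ≠ 0 →
        {w : S.FinPlace | S.satake π w ≠ S.satMultiset lam nu w}.Finite :=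
  Iff.rfl

/-! ### DEFINITIONAL carrier constraints (referee 3 R3-6: "carrier constraints (DEFINITIONAL) — no objection") -/

/-- DEFINITIONAL (carrier constraint, no citation involved): a unitary character has values of absolute value one on
uniformisers
(`λ_w(ϖ_w)`, `ν_M,w(ϖ_w)`). -/
def UnitaryValues : Prop :=
  (∀ (lam : S.HChar) (w : S.FinPlace), ‖S.lval lam w‖ = 1) ∧
    (∀ (nu : S.AChar) (w : S.FinPlace), ‖S.nval nu w‖ = 1)

/-- DEFINITIONAL (carrier constraint, no citation involved): residue fields have at least two elements, `1 < q_w`. -/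
def OneLtQCard : Prop := ∀ w : S.FinPlace, 1 < S.qCard w

/- The standard inputs `Std_heckeCharRigid` (rigidity of Hecke characters) and `Std_autTwist` (`Aut(ℂ)`-twists of
algebraic Hecke characters) are NOT declared in this citable file (referee 3 R3-6 V6): they are the generic predicates
of the non-citable `HodgeCM/Automorphic/StandardInputs.lean`, instantiated below at the carrier's fields and displayed
as explicit hypotheses `(hR : StandardInputs.Std_heckeCharRigid S.lval)`,
`(hT : StandardInputs.Std_autTwist S.InXi S.lval S.qCard S.expo autTwistAct)`. -/

/-- The action of `Aut(ℂ)` on the complex embeddings of `M` by composition (`ρ ↦ τ ∘ ρ`), the `act` argument of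
`StandardInputs.Std_autTwist`. -/
def autTwistAct (τ : ℂ ≃+* ℂ) (ρ : M →+* ℂ) : M →+* ℂ := τ.toRingHom.comp ρ

/-- (Ported verbatim from the HodgeCMPerL package; no docstring in the source.) -/
@[simp] theorem autTwistAct_apply (τ : ℂ ≃+* ℂ) (ρ : M →+* ℂ) (x : M) : autTwistAct τ ρ x = τ (ρ x) := rfl

/-! ### Consequences of (R) -/

/-- [DR15] Def 3.1 read back: the CM type of a pair in `Ξ` is determined by `λ` — `Φ = {τ : expo λ τ = −1}`. -/
theorem mem_iff_expo_eq_neg_one {lam : S.HChar} {nu : S.AChar} {Φ : CMType M}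
    (h : S.IsXiWith lam nu Φ) (τ : M →+* ℂ) : τ ∈ Φ.1 ↔ S.expo lam τ = -1 := by
  constructor
  · intro hτ; exact (h.2.1 τ hτ).1
  · intro hexp
    by_contra hτ
    have hc : conjugate τ ∈ Φ.1 := (conjugate_mem_iff_notMem Φ τ).mpr hτ
    have := (h.2.1 (conjugate τ) hc).2
    rw [show conjugate (conjugate τ) = τ from involutive_conjugate (M : Type) τ] at this
    omega

/-- [Y1neg] L4.2 / PerL v5 l. 97 ("its exponents `m_b(π)` at the complex places `w_b` lie in `{±1}`"), (R)-skeleton: for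
`(λ,ν) ∈ Ξ` the exponent of `λ` at EVERY embedding is `−1` or `+1` (by [DR15] Def 3.1, since every embedding is in `Φ` or
is the conjugate of one in `Φ`). -/
theorem expo_eq_neg_one_or_one {lam : S.HChar} {nu : S.AChar} {Φ : CMType M} (h : S.IsXiWith lam nu Φ)
    (τ : M →+* ℂ) : S.expo lam τ = -1 ∨ S.expo lam τ = 1 := by
  by_cases hτ : τ ∈ Φ.1
  · exact Or.inl (h.2.1 τ hτ).1
  · right
    have hc : conjugate τ ∈ Φ.1 := (conjugate_mem_iff_notMem Φ τ).mpr hτ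
    have := (h.2.1 (conjugate τ) hc).2
    rwa [show conjugate (conjugate τ) = τ from involutive_conjugate (M : Type) τ] at this

/-- [Y1neg] (eq:Phiprime) / PerL v5 display (eq:Phiprime) l. 98–100, (R)-skeleton: the CM type of a pair in `Ξ` IS the set
`{ρ : m_ρ = −1}` ("`Φ'(π) := {ρ_b : m_b(π) = −1} ∪ {ρ̄_b : m_b(π) = +1}`" — the second half is the first read at `ρ̄_b`). -/
theorem cmType_eq_setOf_expo {lam : S.HChar} {nu : S.AChar} {Φ : CMType M} (h : S.IsXiWith lam nu Φ) :
    Φ.1 = {ρ : M →+* ℂ | S.expo lam ρ = -1} := by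
  ext ρ; exact S.mem_iff_expo_eq_neg_one h ρ

/-- Two pairs in `Ξ` with the same `λ` have the same CM type. -/
theorem cmType_eq_of_isXiWith {lam : S.HChar} {nu nu' : S.AChar} {Φ Φ' : CMType M}
    (h : S.IsXiWith lam nu Φ) (h' : S.IsXiWith lam nu' Φ') : Φ = Φ' := by
  apply Subtype.ext
  ext τ
  rw [S.mem_iff_expo_eq_neg_one h, S.mem_iff_expo_eq_neg_one h']

/-- [Y1neg] Prop 5.3's mechanism for a FIXED Hecke character: by the holomorphy dichotomy (`holomorphyDichotomy`,
derived in `HodgeCM.Literature.Rogawski` from [DR15] Thm 3.2), if some member of a packet with character `λ` is `π⁺`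
at `ι`, then no member of any packet in `Ξ` with the same `λ` is `π⁻` (a CM type contains exactly one of `e`, `ē`). -/
theorem not_Jminus_of_Jplus (h1 : S.holomorphyDichotomy) {lam : S.HChar} {nu nu' : S.AChar} {Φ Φ' : CMType M}
    (h : S.IsXiWith lam nu Φ) (h' : S.IsXiWith lam nu' Φ')
    {π π' : S.Rep} (hπ : π ∈ S.packet lam nu) (hπ' : π' ∈ S.packet lam nu')
    (hJ : S.locIota π = S.Jp) : S.locIota π' ≠ S.Jm := by
  obtain ⟨e, -, hrule⟩ := h1
  intro hJ'
  have he : e ∈ Φ.1 := (hrule lam nu Φ h π hπ).1 hJ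
  have he' : conjugate e ∈ Φ'.1 := (hrule lam nu' Φ' h' π' hπ').2 hJ'
  have hΦ : Φ = Φ' := S.cmType_eq_of_isXiWith h h'
  rw [hΦ] at he
  exact ((mem_iff_conjugate_notMem Φ' e).mp he) he'

/-- Extraction step of [Y1neg] Lemma 4.1 (l. 139: "the elements of absolute value `q_w^{±1/2}` are well defined and
determine `μ_w(ϖ_w)`"): in `{x, y√q, y/√q}` with `|x| = |y| = 1 < q`, the element of absolute value `√q` is `y√q`;
hence equal Satake multisets have equal `λ_w(ϖ_w)`. -/
theorem lval_eq_of_satMultiset_eq (hU : S.UnitaryValues) (hq : S.OneLtQCard)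
    {lam lam' : S.HChar} {nu nu' : S.AChar} {w : S.FinPlace}
    (h : S.satMultiset lam nu w = S.satMultiset lam' nu' w) : S.lval lam w = S.lval lam' w := by
  set r : ℂ := (Real.sqrt (S.qCard w) : ℂ) with hr
  have hq1 : (1 : ℝ) < Real.sqrt (S.qCard w) := by
    rw [show (1:ℝ) = Real.sqrt 1 by simp]
    exact Real.sqrt_lt_sqrt (by norm_num) (by exact_mod_cast hq w)
  have hrnorm : ‖r‖ = Real.sqrt (S.qCard w) := by
    rw [hr, Complex.norm_real, Real.norm_eq_abs, abs_of_pos (by linarith)]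
  have hrpos : (0 : ℝ) < ‖r‖ := by rw [hrnorm]; linarith
  have nx : ∀ nu₀ : S.AChar, ‖S.nval nu₀ w‖ = 1 := fun nu₀ => hU.2 nu₀ w
  have ny : ∀ lam₀ : S.HChar, ‖S.lval lam₀ w * r‖ = Real.sqrt (S.qCard w) := by
    intro lam₀; rw [norm_mul, hU.1 lam₀ w, one_mul, hrnorm]
  have nz : ∀ lam₀ : S.HChar, ‖S.lval lam₀ w * r⁻¹‖ = (Real.sqrt (S.qCard w))⁻¹ := by
    intro lam₀; rw [norm_mul, hU.1 lam₀ w, one_mul, norm_inv, hrnorm]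
  have hmem : S.lval lam w * r ∈ S.satMultiset lam' nu' w := by
    rw [← h]; simp [satMultiset, hr]
  simp only [satMultiset, Multiset.mem_cons, Multiset.mem_singleton, Multiset.insert_eq_cons] at hmem
  rcases hmem with h1 | h2 | h3
  · exfalso
    have := congrArg norm h1
    rw [ny, nx] at this; linarith
  · have hr0 : r ≠ 0 := by
      intro h0; rw [h0, norm_zero] at hrpos; exact lt_irrefl _ hrpos
    exact mul_right_cancel₀ hr0 h2
  · exfalso
    have := congrArg norm h3
    rw [ny, nz] at this
    have hlt : (Real.sqrt (S.qCard w))⁻¹ < 1 := inv_lt_one_of_one_lt₀ hq1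
    linarith

/-- **[Y1neg] Lemma 4.1, (R)-skeleton.**  If `π ∈ Π(λ,ν)` and `π' ∈ Π(λ',ν')` (pairs in `Ξ`, both automorphic) have
the same Satake parameters at almost all finite places of `M`, then `λ_w(ϖ_w) = λ'_w(ϖ_w)` at almost all places.
Inputs: `thm32_satake_Y1negReading` + `UnitaryValues` + `OneLtQCard`. -/
theorem lval_eq_ae (hS : S.thm32_satake_Y1negReading) (hU : S.UnitaryValues) (hq : S.OneLtQCard)
    {lam lam' : S.HChar} {nu nu' : S.AChar} (hx : S.InXi lam nu) (hx' : S.InXi lam' nu')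
    {π π' : S.Rep} (hπ : π ∈ S.packet lam nu) (hπ' : π' ∈ S.packet lam' nu')
    (hm : S.m π ≠ 0) (hm' : S.m π' ≠ 0)
    (hsat : {w : S.FinPlace | S.satake π w ≠ S.satake π' w}.Finite) :
    {w : S.FinPlace | S.lval lam w ≠ S.lval lam' w}.Finite := by
  have h1 := (S.thm32_satake_Y1negReading_iff.mp hS) lam nu hx π hπ hm
  have h2 := (S.thm32_satake_Y1negReading_iff.mp hS) lam' nu' hx' π' hπ' hm'
  refine ((h1.union h2).union hsat).subset ?_
  intro w hw
  simp only [Set.mem_union, Set.mem_setOf_eq]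
  by_contra hcon
  push Not at hcon
  obtain ⟨⟨e1, e2⟩, e3⟩ := hcon
  exact hw (S.lval_eq_of_satMultiset_eq hU hq (by rw [← e1, e3, e2]))

/-- **[Y1neg] Proposition 5.3, mechanism for `τ = 1`, over the cited inputs.**  Two automorphic members of packets
in `Ξ` with the same Satake parameters almost everywhere have the same holomorphy type at `ι`: if one is `J⁺` the
other is not `π⁻` (with `π_ι ∈ {π^±}` understood, "not `π⁻`" = "`π⁺`").  Inputs: the holomorphy dichotomy
(`holomorphyDichotomy`, derived from [DR15] Thm 3.2), the Satake reading (`thm32_satake_Y1negReading`), and the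
DEFINITIONAL `UnitaryValues`, `OneLtQCard`; standard input `Std_heckeCharRigid`. -/
theorem holomorphy_determined_by_satake (h1 : S.holomorphyDichotomy) (hS : S.thm32_satake_Y1negReading)
    (hU : S.UnitaryValues) (hq : S.OneLtQCard) (hR : StandardInputs.Std_heckeCharRigid S.lval)
    {lam lam' : S.HChar} {nu nu' : S.AChar} (hx : S.InXi lam nu) (hx' : S.InXi lam' nu')
    {π π' : S.Rep} (hπ : π ∈ S.packet lam nu) (hπ' : π' ∈ S.packet lam' nu')
    (hm : S.m π ≠ 0) (hm' : S.m π' ≠ 0)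
    (hsat : {w : S.FinPlace | S.satake π w ≠ S.satake π' w}.Finite)
    (hJ : S.locIota π = S.Jp) : S.locIota π' ≠ S.Jm := by
  have hlam : lam = lam' := hR lam lam' (S.lval_eq_ae hS hU hq hx hx' hπ hπ' hm hm' hsat)
  subst hlam
  obtain ⟨Φ, hΦ⟩ := hx
  obtain ⟨Φ', hΦ'⟩ := hx'
  exact S.not_Jminus_of_Jplus h1 hΦ hΦ' hπ hπ' hJ

/-- The same with the roles of `J⁺`/`J⁻` exchanged. -/
theorem not_Jplus_of_Jminus_satake (h1 : S.holomorphyDichotomy) (hS : S.thm32_satake_Y1negReading)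
    (hU : S.UnitaryValues) (hq : S.OneLtQCard) (hR : StandardInputs.Std_heckeCharRigid S.lval)
    {lam lam' : S.HChar} {nu nu' : S.AChar} (hx : S.InXi lam nu) (hx' : S.InXi lam' nu')
    {π π' : S.Rep} (hπ : π ∈ S.packet lam nu) (hπ' : π' ∈ S.packet lam' nu')
    (hm : S.m π ≠ 0) (hm' : S.m π' ≠ 0)
    (hsat : {w : S.FinPlace | S.satake π w ≠ S.satake π' w}.Finite)
    (hJ : S.locIota π' = S.Jm) : S.locIota π ≠ S.Jp :=
  fun hJ' => S.holomorphy_determined_by_satake h1 hS hU hq hR hx hx' hπ hπ' hm hm' hsat hJ' hJ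

/-! ### The Galois-twisted form: [Y1neg] Lemma 5.2 and Proposition 5.3 for general `τ ∈ Aut(ℂ)` -/

/-- Ratio extraction ([Y1neg] L5.2 proof): if `τ ∈ Aut(ℂ)` maps the Satake multiset of `(λ,ν)` at `w` onto that of
`(λ',ν')`, then `τ(λ_w(ϖ)√q) = λ'_w(ϖ)√q` ("the only ordered pair with ratio `q_w` is `(y', y'/q)`"). -/
theorem twist_lval_of_satMultiset_map (hU : S.UnitaryValues) (hq : S.OneLtQCard) (τ : ℂ ≃+* ℂ)
    {lam lam' : S.HChar} {nu nu' : S.AChar} {w : S.FinPlace}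
    (h : (S.satMultiset lam nu w).map τ = S.satMultiset lam' nu' w) :
    τ (S.lval lam w * (Real.sqrt (S.qCard w) : ℂ)) = S.lval lam' w * (Real.sqrt (S.qCard w) : ℂ) := by
  obtain ⟨r, hr⟩ : ∃ r : ℂ, (Real.sqrt (S.qCard w) : ℂ) = r := ⟨_, rfl⟩
  obtain ⟨s, hs⟩ : ∃ s : ℝ, Real.sqrt (S.qCard w) = s := ⟨_, rfl⟩
  have hs1 : 1 < s := by
    rw [← hs, show (1:ℝ) = Real.sqrt 1 by simp]
    exact Real.sqrt_lt_sqrt (by norm_num) (by exact_mod_cast hq w)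
  have hs0 : 0 < s := by linarith
  have hs2 : 1 < s * s := by nlinarith
  have hs3 : 1 < s * s * s := by nlinarith
  have hrs : r = (s : ℂ) := by rw [← hr, hs]
  have hrnorm : ‖r‖ = s := by rw [hrs, Complex.norm_real, Real.norm_eq_abs, abs_of_pos hs0]
  have hr0 : r ≠ 0 := by intro h0; rw [h0, norm_zero] at hrnorm; linarith
  have hss : s * s = (S.qCard w : ℝ) := by rw [← hs, Real.mul_self_sqrt (Nat.cast_nonneg _)]
  have hrr : r * r = (S.qCard w : ℂ) := by rw [hrs]; exact_mod_cast hss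
  have hτq : τ (S.qCard w : ℂ) = (S.qCard w : ℂ) := map_natCast τ _
  simp only [satMultiset, hr, Multiset.insert_eq_cons, Multiset.map_cons, Multiset.map_singleton] at h ⊢
  -- the two relevant members of the source multiset, mapped by τ, lie in the target multiset
  have hmem1 : τ (S.lval lam w * r) ∈ (S.nval nu' w ::ₘ S.lval lam' w * r ::ₘ ({S.lval lam' w * r⁻¹} : Multiset ℂ)) := by
    rw [← h]; simp
  have hmem2 : τ (S.lval lam w * r⁻¹) ∈ (S.nval nu' w ::ₘ S.lval lam' w * r ::ₘ ({S.lval lam' w * r⁻¹} : Multiset ℂ)) := by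
    rw [← h]; simp
  -- τ(l r) = τ(l r⁻¹) · q
  have hrel : τ (S.lval lam w * r) = τ (S.lval lam w * r⁻¹) * (S.qCard w : ℂ) := by
    rw [← hτq, ← map_mul]; congr 1
    rw [← hrr]; field_simp
  -- norms in the target multiset
  have nx : ‖S.nval nu' w‖ = 1 := hU.2 nu' w
  have ny : ‖S.lval lam' w * r‖ = s := by rw [norm_mul, hU.1 lam' w, one_mul, hrnorm]
  have nz : ‖S.lval lam' w * r⁻¹‖ = s⁻¹ := by rw [norm_mul, hU.1 lam' w, one_mul, norm_inv, hrnorm]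
  have hqn : ‖(S.qCard w : ℂ)‖ = s * s := by rw [Complex.norm_natCast, hss]
  have hnrel : ‖τ (S.lval lam w * r)‖ = ‖τ (S.lval lam w * r⁻¹)‖ * (s * s) := by rw [hrel, norm_mul, hqn]
  simp only [Multiset.mem_cons, Multiset.mem_singleton] at hmem1 hmem2
  have hsinv : s⁻¹ * s = 1 := inv_mul_cancel₀ (ne_of_gt hs0)
  rcases hmem1 with a1 | a1 | a1
  · exfalso
    have e1 := congrArg norm a1; rw [hnrel, nx] at e1
    rcases hmem2 with b1 | b1 | b1
    · rw [b1, nx] at e1; nlinarith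
    · rw [b1, ny] at e1; nlinarith
    · rw [b1, nz] at e1
      have : s⁻¹ * (s * s) = s := by rw [← mul_assoc, hsinv, one_mul]
      rw [this] at e1; linarith
  · exact a1
  · exfalso
    have e1 := congrArg norm a1; rw [hnrel, nz] at e1
    rcases hmem2 with b1 | b1 | b1
    · rw [b1, nx] at e1
      have : s⁻¹ < 1 := inv_lt_one_of_one_lt₀ hs1
      nlinarith
    · rw [b1, ny] at e1
      have : s⁻¹ < 1 := inv_lt_one_of_one_lt₀ hs1
      nlinarith
    · rw [b1, nz] at e1
      have : s⁻¹ * (s * s) = s := by rw [← mul_assoc, hsinv, one_mul]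
      rw [this] at e1
      have : s⁻¹ < 1 := inv_lt_one_of_one_lt₀ hs1
      linarith


/-- **[Y1neg] Lemma 5.2 "conjugation of the type", (R)-skeleton, general `τ ∈ Aut(ℂ)`.**  Let `π ∈ Π(λ,ν)`, `π' ∈ Π(λ',ν')`
be automorphic, `(λ,ν), (λ',ν') ∈ Ξ` with CM types `Φ`, `Φ'`, and suppose the Satake parameters of `π'` are the
`τ`-conjugates of those of `π` at almost all places (this is how "`π'` contributes to the `a^τ`-eigenspace" enters, via
[Y1neg] (eq:satconj) — an input OUTSIDE this file).  Then `Φ' = τΦ`: `τ ∘ ρ ∈ Φ' ↔ ρ ∈ Φ`.  Inputs: the Satake reading (U),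
`UnitaryValues`, `OneLtQCard` (DEFINITIONAL), `Std_heckeCharRigid`, `Std_autTwist` (standard inputs, non-citable file). -/
theorem cmType_twist_of_satake_twist (hS : S.thm32_satake_Y1negReading) (hU : S.UnitaryValues) (hq : S.OneLtQCard)
    (hR : StandardInputs.Std_heckeCharRigid S.lval)
    (hT : StandardInputs.Std_autTwist S.InXi S.lval S.qCard S.expo autTwistAct) (τ : ℂ ≃+* ℂ)
    {lam lam' : S.HChar} {nu nu' : S.AChar} {Φ Φ' : CMType M}
    (hx : S.IsXiWith lam nu Φ) (hx' : S.IsXiWith lam' nu' Φ')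
    {π π' : S.Rep} (hπ : π ∈ S.packet lam nu) (hπ' : π' ∈ S.packet lam' nu')
    (hm : S.m π ≠ 0) (hm' : S.m π' ≠ 0)
    (hconj : {w : S.FinPlace | S.satake π' w ≠ (S.satake π w).map τ}.Finite) (ρ : M →+* ℂ) :
    τ.toRingHom.comp ρ ∈ Φ'.1 ↔ ρ ∈ Φ.1 := by
  obtain ⟨lamτ, hval, hexp⟩ := hT τ lam nu ⟨Φ, hx⟩
  have hexp' : ∀ ρ' : M →+* ℂ, S.expo lamτ (τ.toRingHom.comp ρ') = S.expo lam ρ' := hexp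
  -- λ' agrees with λ^τ at almost all places
  have h1 := (S.thm32_satake_Y1negReading_iff.mp hS) lam nu ⟨Φ, hx⟩ π hπ hm
  have h2 := (S.thm32_satake_Y1negReading_iff.mp hS) lam' nu' ⟨Φ', hx'⟩ π' hπ' hm'
  have hfin : {w : S.FinPlace | S.lval lamτ w ≠ S.lval lam' w}.Finite := by
    refine ((h1.union h2).union hconj).subset ?_
    intro w hw
    simp only [Set.mem_union, Set.mem_setOf_eq]
    by_contra hcon
    push Not at hcon
    obtain ⟨⟨e1, e2⟩, e3⟩ := hcon
    have hmap : (S.satMultiset lam nu w).map τ = S.satMultiset lam' nu' w := by rw [← e1, ← e3, e2]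
    have ht := S.twist_lval_of_satMultiset_map hU hq τ hmap
    have hr0 : (Real.sqrt (S.qCard w) : ℂ) ≠ 0 := by
      have : (0 : ℝ) < Real.sqrt (S.qCard w) := Real.sqrt_pos.mpr (by exact_mod_cast Nat.lt_of_lt_of_le Nat.zero_lt_one (hq w).le)
      exact_mod_cast this.ne'
    exact hw (mul_right_cancel₀ hr0 ((hval w).trans ht))
  have hlam : lamτ = lam' := hR lamτ lam' hfin
  subst hlam
  rw [S.mem_iff_expo_eq_neg_one hx' (τ.toRingHom.comp ρ), S.mem_iff_expo_eq_neg_one hx ρ, hexp' ρ]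

/-- **[Y1neg] Proposition 5.3 "purity and the holomorphy criterion", (R)-skeleton, general `τ`.**  In the situation of
`cmType_twist_of_satake_twist`, if moreover `π'_ι ≅ π^±` (it contributes to `H¹`) then `π'` is holomorphic (`π'_ι ≅ π⁺`)
iff `τ⁻¹ ∘ e ∈ Φ`, where `e ∈ {ι, ῑ}` is the fixed embedding of the holomorphy dichotomy — i.e. "the `a^τ`-eigenspace is
of type `(1,0)` iff `φ₁^h ∈ τΦ'(π)`" (Y1neg ll. 174–179).  Inputs: `holomorphyDichotomy` (DERIVED from DR15), plus those of
`cmType_twist_of_satake_twist`. -/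
theorem holomorphic_iff_of_satake_twist (hD : S.holomorphyDichotomy) (hS : S.thm32_satake_Y1negReading)
    (hU : S.UnitaryValues) (hq : S.OneLtQCard) (hR : StandardInputs.Std_heckeCharRigid S.lval)
    (hT : StandardInputs.Std_autTwist S.InXi S.lval S.qCard S.expo autTwistAct) (τ : ℂ ≃+* ℂ)
    {lam lam' : S.HChar} {nu nu' : S.AChar} {Φ Φ' : CMType M}
    (hx : S.IsXiWith lam nu Φ) (hx' : S.IsXiWith lam' nu' Φ')
    {π π' : S.Rep} (hπ : π ∈ S.packet lam nu) (hπ' : π' ∈ S.packet lam' nu')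
    (hm : S.m π ≠ 0) (hm' : S.m π' ≠ 0)
    (hconj : {w : S.FinPlace | S.satake π' w ≠ (S.satake π w).map τ}.Finite)
    (hJ' : S.IsJpmAtIota π') :
    ∃ e : M →+* ℂ, e ∈ placeSet ι ∧
      (∀ (l : S.HChar) (n : S.AChar) (Ψ : CMType M), S.IsXiWith l n Ψ → ∀ p ∈ S.packet l n,
          (S.locIota p = S.Jp → e ∈ Ψ.1) ∧ (S.locIota p = S.Jm → conjugate e ∈ Ψ.1)) ∧
      (S.locIota π' = S.Jp ↔ τ.symm.toRingHom.comp e ∈ Φ.1) := by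
  obtain ⟨e, he, hrule⟩ := hD
  refine ⟨e, he, hrule, ?_⟩
  have key : τ.toRingHom.comp (τ.symm.toRingHom.comp e) = e := by
    ext x; simp
  have hΦ' : e ∈ Φ'.1 ↔ τ.symm.toRingHom.comp e ∈ Φ.1 := by
    have := S.cmType_twist_of_satake_twist hS hU hq hR hT τ hx hx' hπ hπ' hm hm' hconj (τ.symm.toRingHom.comp e)
    rw [key] at this
    exact this
  rw [← hΦ']
  constructor
  · intro hp; exact (hrule lam' nu' Φ' hx' π' hπ').1 hp
  · intro heΦ'
    rcases hJ' with hp | hm2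
    · exact hp
    · exfalso
      have := (hrule lam' nu' Φ' hx' π' hπ').2 hm2
      exact ((mem_iff_conjugate_notMem Φ' e).mp heΦ') this

end Literature.Rogawski.U3Spectrum

end HodgeCM

end
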